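import Summits.AtomisticToContinuum.BoseEinsteinCondensation.Theorems.BECCutLineWeakDisorderGroundStateRigidityStubCompactness
import HarnessLib

/-!
# Route `BECRieszReverseHolder`, crux `CoarseGrainedReverseHolder`
# (stmt-AtomisticToContinuum-12840), line `registered`:
# the registered stub `stub_nearMinimiserNearGroundState`

Supports (does not close) stmt-AtomisticToContinuum-12840. **Non-negative near-minimisers are
`L²`-close to non-negative ground states** (the compactness input of the transfer of the
coarse-grained reverse-Hölder bound from ground states to near-minimisers). At FIXED `(v, N, L)`
with `E₀ = groundStateEnergy v N L < ⊤`: for every `η > 0` there is `δ > 0` such that every trial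
state `Ψ ≥ 0` (`Ψ = ‖Ψ‖` pointwise) with `energy v Ψ ≤ E₀ + δ` admits a ground state `Φ ≥ 0`
(`IsGroundState v L Φ`, `Φ = ‖Φ‖` pointwise) with `∫ |Ψ − Φ|² ≤ η`. No uniqueness of the ground
state is claimed or used.

## Proof

By contradiction along `δ_k = 1/(k+1)`: if for every `k` some non-negative `δ_k`-near-minimiser
`Ψ_k` is `η`-far (in `∫|·|²`) from EVERY non-negative ground state, then the energies of the `Ψ_k`
are `≤ E₀ + 1 < ⊤`, so the landed compactness theorem
`GroundStateRigidity.stub_compactness` (Rellich–Kondrachov on the box,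
Theorems/BECCutLineWeakDisorderGroundStateRigidityStubCompactness) extracts `Ψ_{φ k} → Ψ∞` in `L²`
with `Ψ∞` measurable, Dirichlet and Bose-symmetric. Since each `Ψ_k` is real non-negative,
`|Ψ_k − |Ψ∞|| ≤ |Ψ_k − Ψ∞|` pointwise (`||a| − |b|| ≤ |a − b|`), so also `Ψ_{φ k} → |Ψ∞|` in `L²`;
and `|Ψ∞|` is measurable, Dirichlet, symmetric, with
`liminf energy v Ψ_{φ k} ≤ lim (E₀ + δ_{φ k}) = E₀`, hence a (non-negative) ground state by
`IsGroundState.of_tendstoL2`. But then eventually `∫ |Ψ_{φ k} − |Ψ∞||² < η`, contradicting the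
choice of the `Ψ_k`.
-/

noncomputable section

open MeasureTheory Filter
open scoped ENNReal NNReal Topology

namespace Summit.AtomisticToContinuum.BoseEinsteinCondensation.Theorems.CoarseGrainedReverseHolder

open Literature.MathematicalPhysics.QuantumManyBody
open Literature.MathematicalPhysics.QuantumManyBody.BoseGas

namespace NearMinimiser

/-- For a real non-negative complex number `u` (`u = ‖u‖`) and any `w`:
`‖u − ‖w‖‖ ≤ ‖u − w‖` (`||a| − |b|| ≤ |a − b|` with `|u| = u`). [folklore] -/
theorem norm_sub_ofReal_norm_le {u w : ℂ} (hu : u = ((‖u‖ : ℝ) : ℂ)) :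
    ‖u - ((‖w‖ : ℝ) : ℂ)‖ ≤ ‖u - w‖ := by
  calc ‖u - ((‖w‖ : ℝ) : ℂ)‖ = ‖((‖u‖ : ℝ) : ℂ) - ((‖w‖ : ℝ) : ℂ)‖ := by rw [← hu]
    _ = |‖u‖ - ‖w‖| := by rw [← Complex.ofReal_sub, Complex.norm_real, Real.norm_eq_abs]
    _ ≤ ‖u - w‖ := abs_norm_sub_norm_le u w

/-- Squared `ℝ≥0∞` form of `norm_sub_ofReal_norm_le`: for `u = ‖u‖`,
`‖u − ‖w‖‖₊² ≤ ‖u − w‖₊²` in `[0, ∞]`. [folklore] -/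
theorem coe_nnnorm_sub_ofReal_norm_sq_le {u w : ℂ} (hu : u = ((‖u‖ : ℝ) : ℂ)) :
    (‖u - ((‖w‖ : ℝ) : ℂ)‖₊ : ℝ≥0∞) ^ 2 ≤ (‖u - w‖₊ : ℝ≥0∞) ^ 2 := by
  have h : ‖u - ((‖w‖ : ℝ) : ℂ)‖₊ ≤ ‖u - w‖₊ :=
    NNReal.coe_le_coe.1 (by simpa only [coe_nnnorm] using norm_sub_ofReal_norm_le (w := w) hu)
  exact pow_le_pow_left' (ENNReal.coe_le_coe.2 h) 2

/-- **`L²`-convergence to the modulus of the limit.** If real non-negative trial states `Φₙ`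
(`Φₙ = ‖Φₙ‖` pointwise) converge in `L²` to `Ψ`, they also converge in `L²` to `|Ψ|`
(pointwise `|Φₙ − |Ψ|| ≤ |Φₙ − Ψ|`). [folklore] -/
theorem tendstoL2_ofReal_norm {N : ℕ} {L : ℝ} {Φ : ℕ → TrialState N L} {Ψ : Config N → ℂ}
    (hΦ : ∀ n X, (Φ n).ψ X = ((‖(Φ n).ψ X‖ : ℝ) : ℂ)) (h : TendstoL2 Φ Ψ) :
    TendstoL2 Φ (fun X => ((‖Ψ X‖ : ℝ) : ℂ)) :=
  tendsto_of_tendsto_of_tendsto_of_le_of_le tendsto_const_nhds h (fun _ => zero_le) fun n =>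
    lintegral_mono fun X => coe_nnnorm_sub_ofReal_norm_sq_le (hΦ n X)

/-- **The modulus of an `L²`-limit of asymptotic minimisers is a non-negative ground state.** If
trial states `Φₙ → Ψ` in `L²` with `Ψ` measurable, Dirichlet and Bose-symmetric, `E₀ < ⊤`, and
`energy v Φₙ ≤ bₙ` with `bₙ → E₀`, and the `Φₙ` are real non-negative, then `|Ψ|` (complexified)
is a ground state (`IsGroundState.of_tendstoL2` along `Φₙ → |Ψ|`). [folklore] -/
theorem isGroundState_ofReal_norm {N : ℕ} {L : ℝ} (v : ℝ → ℝ≥0∞) {Φ : ℕ → TrialState N L}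
    {Ψ : Config N → ℂ} (hm : Measurable Ψ) (h0 : ∀ X, X ∉ boxN N L → Ψ X = 0)
    (hs : ∀ (σ : Equiv.Perm (Fin N)) (X : Config N), Ψ (X ∘ σ) = Ψ X)
    (hE : groundStateEnergy v N L ≠ ⊤)
    (hΦ : ∀ n X, (Φ n).ψ X = ((‖(Φ n).ψ X‖ : ℝ) : ℂ)) (hL2 : TendstoL2 Φ Ψ)
    {b : ℕ → ℝ≥0∞} (hb : Tendsto b atTop (𝓝 (groundStateEnergy v N L)))
    (hΦb : ∀ n, energy v (Φ n) ≤ b n) :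
    IsGroundState v L (fun X => ((‖Ψ X‖ : ℝ) : ℂ)) := by
  refine IsGroundState.of_tendstoL2 (Complex.measurable_ofReal.comp hm.norm)
    (fun X hX => by simp [h0 X hX]) (fun σ X => by simp only [hs σ X]) hE
    (tendstoL2_ofReal_norm hΦ hL2) ?_
  exact (liminf_le_liminf (Eventually.of_forall hΦb)).trans hb.liminf_eq.le

end NearMinimiser

/-! ### The stub -/

open NearMinimiser in
/-- **Stub `stub_nearMinimiserNearGroundState` of line `registered` — non-negative near-minimisers
are `L²`-close to non-negative ground states.** At fixed `(v, N, L)` with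
`groundStateEnergy v N L < ⊤`: for every `η > 0` there is `δ > 0` such that every trial state
`Ψ = ‖Ψ‖` with `energy v Ψ ≤ E₀ + δ` has a ground state `Φ = ‖Φ‖` (`IsGroundState v L Φ`) with
`∫ |Ψ − Φ|² ≤ η`. By contradiction along `δ_k = 1/(k+1)`: the offending `Ψ_k` have energies
`≤ E₀ + 1`, compactness (`GroundStateRigidity.stub_compactness`) gives `Ψ_{φ k} → Ψ∞` in `L²`
with `Ψ∞` measurable, Dirichlet, symmetric; as `Ψ_k ≥ 0` also `Ψ_{φ k} → |Ψ∞|`, and `|Ψ∞|` is a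
ground state (`IsGroundState.of_tendstoL2`, `liminf energy ≤ E₀`), contradicting
`∫|Ψ_{φ k} − |Ψ∞||² > η` for all `k`. [cite: ReedSimonIV1978, Thm XIII.64] -/
theorem stub_nearMinimiserNearGroundState :
    ∀ (v : ℝ → ENNReal) (N : ℕ) (L : ℝ), BoseGas.groundStateEnergy v N L ≠ ⊤ →
    ∀ η : ℝ, 0 < η → ∃ δ : ENNReal, 0 < δ ∧
      ∀ Ψ : BoseGas.TrialState N L,
        BoseGas.energy v Ψ ≤ BoseGas.groundStateEnergy v N L + δ →
        (∀ X, Ψ.ψ X = (‖Ψ.ψ X‖ : ℂ)) →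
        ∃ Φ : BoseGas.Config N → ℂ, BoseGas.IsGroundState v L Φ ∧ (∀ X, Φ X = (‖Φ X‖ : ℂ)) ∧
          ∫⁻ X, (‖Ψ.ψ X - Φ X‖₊ : ENNReal) ^ 2 ≤ ENNReal.ofReal η := by
  intro v N L hE η hη
  by_contra h
  push Not at h
  -- an offending non-negative `1/(k+1)`-near-minimiser for every `k`
  have hpos : ∀ k : ℕ, (0 : ℝ≥0∞) < ((k + 1 : ℕ) : ℝ≥0∞)⁻¹ := fun k =>
    ENNReal.inv_pos.2 (ENNReal.natCast_ne_top _)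
  choose Ψ hΨE hΨpos hΨfar using fun k : ℕ => h _ (hpos k)
  -- compactness: a subsequence converges in `L²`
  have hEtop : groundStateEnergy v N L + 1 ≠ ⊤ := ENNReal.add_ne_top.2 ⟨hE, ENNReal.one_ne_top⟩
  obtain ⟨Ψ₁, φ, hφ, hm, h0, hσ, hL2⟩ := GroundStateRigidity.stub_compactness N L v _ Ψ hEtop
    fun k => (hΨE k).trans
      (add_le_add le_rfl (ENNReal.inv_le_one.2 (by exact_mod_cast Nat.le_add_left 1 k)))
  -- the energies along the subsequence tend to `E₀`
  have hup : Tendsto (fun k => groundStateEnergy v N L + ((φ k + 1 : ℕ) : ℝ≥0∞)⁻¹) atTop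
      (𝓝 (groundStateEnergy v N L)) := by
    have h' := ((ENNReal.tendsto_inv_nat_nhds_zero.comp (tendsto_add_atTop_nat 1)).comp
      hφ.tendsto_atTop).const_add (groundStateEnergy v N L)
    rwa [add_zero] at h'
  -- `|Ψ₁|` is a non-negative ground state and the subsequence converges to it
  have hΦpos : ∀ k X, (Ψ (φ k)).ψ X = ((‖(Ψ (φ k)).ψ X‖ : ℝ) : ℂ) := fun k X => hΨpos (φ k) X
  have hgs : IsGroundState v L (fun X => ((‖Ψ₁ X‖ : ℝ) : ℂ)) :=
    isGroundState_ofReal_norm v hm h0 hσ hE hΦpos hL2 hup fun k => hΨE (φ k)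
  have hnn : ∀ X, (fun X => ((‖Ψ₁ X‖ : ℝ) : ℂ)) X = ((‖(fun X => ((‖Ψ₁ X‖ : ℝ) : ℂ)) X‖ : ℝ) : ℂ) :=
    fun X => by simp only [Complex.norm_real, norm_norm]
  have hL2' : TendstoL2 (fun k => Ψ (φ k)) (fun X => ((‖Ψ₁ X‖ : ℝ) : ℂ)) :=
    tendstoL2_ofReal_norm hΦpos hL2
  -- contradiction: eventually `η`-close, yet `η`-far for every `k`
  obtain ⟨k, hk⟩ := (hL2'.eventually (gt_mem_nhds (ENNReal.ofReal_pos.2 hη))).exists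
  exact absurd hk (not_lt.2 (hΨfar (φ k) _ hgs hnn).le)

end Summit.AtomisticToContinuum.BoseEinsteinCondensation.Theorems.CoarseGrainedReverseHolder

end
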